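import Literature.Topology.Immersions.ProjBundleCompl
import Literature.Topology.Immersions.DoublePointsGenericity
import Literature.Topology.Immersions.HirschImmersionTwisted
import Literature.Topology.Immersions.SurjectiveDifferentialOpen
import Literature.Topology.Immersions.LinearRemodel
import Literature.Topology.FourManifolds.RegularValuePreimage
import Literature.Geometry.Manifold.OpenSubmanifoldMFDeriv
import HarnessLib

/-!
# The zero set of a transverse section is a submanifold

Topic `Literature/Topology/Immersions`. Let `E = E(P)` be a rank-`k` bundle in `M × ℝᵐ` over an
`n`-manifold (`ProjectionFieldBundle.lean`) and `s` a `C^∞` section whose zeros are transverse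
(the fibre component `v ↦ P_x(ds_x v)` of `ds` is onto `E_x` at every zero; generic by
`ProjBundleGenericSection.lean`). Then **the zero set `{s = 0}` is an embedded submanifold of
`M` of dimension `n - k`** with tangent spaces `ker (v ↦ P_x(ds_x v))` (Hirsch, *Differential
Topology* (1976), Ch. 1 Thm. 3.2 / Ch. 4 §2; Bott–Tu, *Differential Forms in Algebraic
Topology*, §6 p. 71 ff.; the basic fact behind "the Euler class is Poincaré dual to the zero
locus of a transverse section", Milnor–Stasheff §11 / Kirby (1989) Ch. II p. 22).

We realise the zero set as a REGULAR PREIMAGE, so that the tree's `exists_regularPreimage`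
applies without any gluing: on the total space of the complementary bundle `E^⊥`
(`ProjBundle.compl`, a manifold by `ProjectionFieldBundle.lean`) the map

  `G(x, w) = s(x) + w ∈ ℝᵐ`   (`w ∈ E^⊥_x`)

vanishes exactly on `{(x, 0) : s x = 0}` (`s x ∈ E_x`, `w ∈ E_x^⊥`), and at such points `dG`
is onto `ℝᵐ`: the vertical directions give `E^⊥_x` and, by transversality, the zero-section
directions give the `E_x`-components.

* `ProjBundle.exists_zeroSetManifold` — a `C^∞` manifold `Z` (Hausdorff, second countable,
  modelled on `ℝᵈ`, `k + d = n`) with an injective `C^∞` immersion `ι : Z → M`, a topological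
  embedding, onto `{s = 0}`, whose differential has range `{v | P_x(ds_x v) = 0}`.

Everything here is proved; no definitions, no named facts.

## References

* M. W. Hirsch, *Differential Topology*, GTM 33 (1976), Ch. 1 Thm. 3.2, Ch. 4 §2. [HirschDT1976]
* J. Milnor, J. Stasheff, *Characteristic Classes* (1974), §11. [MilnorStasheff1974]
-/

open scoped Manifold ContDiff Topology
open Set Function Module

noncomputable section

universe u

namespace Literature.Topology.Immersions

/-- Local notation: `𝔼 n` is the model Euclidean space `EuclideanSpace ℝ (Fin n)`. -/
local notation "𝔼 " n:arg => EuclideanSpace ℝ (Fin n)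

open Literature.Topology.FourManifolds (exists_regularPreimage injective_mfderiv_of_isImmersionAt')
open Literature.Geometry.Manifold.OpenSubmanifold (mfderiv_subtype_val mdifferentiableAt_subtype_val)

namespace ProjBundle

variable {n m k k' : ℕ} {M : Type u} [TopologicalSpace M] [ChartedSpace (𝔼 n) M]

/-! ### The defining map on the total space of `E^⊥` -/

section Defs

variable (P : ProjBundle n m k M) (hk : k + k' = m)

/-- **The defining map `G(x, w) = s x + w`** on the total space of `E^⊥`. [folklore] -/
def zeroSetMap (s : M → 𝔼 m) : (P.compl hk).Total → 𝔼 m :=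
  fun p => s ((P.compl hk).base p) + (P.compl hk).vec p

/-- `G (x, w) = s x + w`. [folklore] -/
theorem zeroSetMap_apply (s : M → 𝔼 m) (p : (P.compl hk).Total) :
    P.zeroSetMap hk s p = s ((P.compl hk).base p) + (P.compl hk).vec p := rfl

/-- **Zeros of `G`** are the points `(x, 0)` with `s x = 0` (for a section `s`). [folklore] -/
theorem zeroSetMap_eq_zero_iff {s : M → 𝔼 m} (hsec : ∀ x, P.proj x (s x) = s x)
    (p : (P.compl hk).Total) :
    P.zeroSetMap hk s p = 0 ↔ s ((P.compl hk).base p) = 0 ∧ (P.compl hk).vec p = 0 := by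
  rw [zeroSetMap_apply]
  constructor
  · intro h
    have hsx : s ((P.compl hk).base p) ∈ P.fibre ((P.compl hk).base p) :=
      P.mem_fibre_iff.2 (hsec _)
    have hv : (P.compl hk).vec p ∈ (P.compl hk).fibre ((P.compl hk).base p) :=
      (P.compl hk).vec_mem_fibre p
    have hs' : s ((P.compl hk).base p) = -(P.compl hk).vec p := eq_neg_of_add_eq_zero_left h
    have hneg : -(P.compl hk).vec p ∈ (P.compl hk).fibre ((P.compl hk).base p) :=
      Submodule.neg_mem _ hv
    have h0 : s ((P.compl hk).base p) = 0 :=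
      P.eq_zero_of_mem_fibre_of_mem_fibre_compl hk _ hsx (hs' ▸ hneg)
    refine ⟨h0, ?_⟩
    rwa [h0, zero_add] at h
  · rintro ⟨h1, h2⟩
    rw [h1, h2, add_zero]

end Defs

/-! ### Tangent vectors of the total space -/

variable [IsManifold (𝓡 n) ∞ M]

/-- `d(retr)` is onto the tangent space of the total space: `ξ = d(retr) (d(incl) ξ)`.
[folklore] -/
theorem mfderiv_retr_mfderiv_incl (Q : ProjBundle n m k' M) (p : Q.Total)
    (ξ : TangentSpace 𝓘(ℝ, 𝔼 n × 𝔼 k') p) :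
    mfderiv ((𝓡 n).prod (𝓡 m)) 𝓘(ℝ, 𝔼 n × 𝔼 k') Q.retr (Q.incl p)
      (mfderiv 𝓘(ℝ, 𝔼 n × 𝔼 k') ((𝓡 n).prod (𝓡 m)) Q.incl p ξ) = ξ := by
  have hr : MDifferentiableAt ((𝓡 n).prod (𝓡 m)) 𝓘(ℝ, 𝔼 n × 𝔼 k') Q.retr (Q.incl p) :=
    (Q.contMDiff_retr _).mdifferentiableAt (by simp)
  have hi : MDifferentiableAt 𝓘(ℝ, 𝔼 n × 𝔼 k') ((𝓡 n).prod (𝓡 m)) Q.incl p :=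
    (Q.contMDiff_incl _).mdifferentiableAt (by simp)
  have h := mfderiv_comp p hr hi
  have hid : Q.retr ∘ Q.incl = id := funext Q.retr_incl
  rw [hid, mfderiv_id] at h
  exact (DFunLike.congr_fun h ξ).symm

/-- `d(incl) ξ = (d(base) ξ, d(vec) ξ)`. [folklore] -/
theorem mfderiv_incl_eq (Q : ProjBundle n m k' M) (p : Q.Total)
    (ξ : TangentSpace 𝓘(ℝ, 𝔼 n × 𝔼 k') p) :
    mfderiv 𝓘(ℝ, 𝔼 n × 𝔼 k') ((𝓡 n).prod (𝓡 m)) Q.incl p ξ =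
      (mfderiv 𝓘(ℝ, 𝔼 n × 𝔼 k') (𝓡 n) Q.base p ξ,
        mfderiv 𝓘(ℝ, 𝔼 n × 𝔼 k') (𝓡 m) Q.vec p ξ) := by
  have hb : MDifferentiableAt 𝓘(ℝ, 𝔼 n × 𝔼 k') (𝓡 n) Q.base p :=
    (Q.contMDiff_base _).mdifferentiableAt (by simp)
  have hv : MDifferentiableAt 𝓘(ℝ, 𝔼 n × 𝔼 k') (𝓡 m) Q.vec p :=
    (Q.contMDiff_vec _).mdifferentiableAt (by simp)
  have hfun : Q.incl = fun p => (Q.base p, Q.vec p) := rfl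
  rw [hfun, hb.mfderiv_prod hv]
  rfl

/-- A tangent vector of the total space with vanishing base and fibre components vanishes.
[folklore] -/
theorem eq_zero_of_mfderiv_base_vec_eq_zero (Q : ProjBundle n m k' M) (p : Q.Total)
    (ξ : TangentSpace 𝓘(ℝ, 𝔼 n × 𝔼 k') p)
    (h1 : mfderiv 𝓘(ℝ, 𝔼 n × 𝔼 k') (𝓡 n) Q.base p ξ = 0)
    (h2 : mfderiv 𝓘(ℝ, 𝔼 n × 𝔼 k') (𝓡 m) Q.vec p ξ = 0) : ξ = 0 := by
  rw [← Q.mfderiv_retr_mfderiv_incl p ξ, Q.mfderiv_incl_eq, h1, h2]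
  exact map_zero _

variable (P : ProjBundle n m k M) (hk : k + k' = m)

/-- `G` is `C^∞`. [folklore] -/
theorem contMDiff_zeroSetMap {s : M → 𝔼 m} (hs : ContMDiff (𝓡 n) (𝓡 m) ∞ s) :
    ContMDiff 𝓘(ℝ, 𝔼 n × 𝔼 k') (𝓡 m) ∞ (P.zeroSetMap hk s) :=
  (hs.comp (P.compl hk).contMDiff_base).add (P.compl hk).contMDiff_vec

/-- **The differential of `G` on lifted vectors at a point of the zero section**:
`dG (d retr (X, W)) = ds_x X + (1 - P_x) W`. [folklore] -/
theorem mfderiv_zeroSetMap_retr {s : M → 𝔼 m} (hs : ContMDiff (𝓡 n) (𝓡 m) ∞ s)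
    (x : M) (X : 𝔼 n) (W : 𝔼 m) :
    mfderiv 𝓘(ℝ, 𝔼 n × 𝔼 k') (𝓡 m) (P.zeroSetMap hk s) ((P.compl hk).retr (x, 0))
      (mfderiv ((𝓡 n).prod (𝓡 m)) 𝓘(ℝ, 𝔼 n × 𝔼 k') (P.compl hk).retr (x, 0) (X, W)) =
      ediff n m s x X + (P.compl hk).proj x W := by
  set Q := P.compl hk
  have hG := P.contMDiff_zeroSetMap hk hs
  have hGd : MDifferentiableAt 𝓘(ℝ, 𝔼 n × 𝔼 k') (𝓡 m) (P.zeroSetMap hk s) (Q.retr (x, 0)) :=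
    (hG _).mdifferentiableAt (by simp)
  have hr : MDifferentiableAt ((𝓡 n).prod (𝓡 m)) 𝓘(ℝ, 𝔼 n × 𝔼 k') Q.retr (x, 0) :=
    (Q.contMDiff_retr _).mdifferentiableAt (by simp)
  -- `G ∘ retr = H`, `H (y, w) = s y + Q_y w`
  have hH : P.zeroSetMap hk s ∘ Q.retr = fun q : M × 𝔼 m => s q.1 + Q.proj q.1 q.2 := rfl
  have hHs : ContMDiff ((𝓡 n).prod (𝓡 m)) (𝓡 m) ∞ fun q : M × 𝔼 m => s q.1 + Q.proj q.1 q.2 :=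
    (hs.comp contMDiff_fst).add ((Q.contMDiff_proj'.comp contMDiff_fst).clm_apply contMDiff_snd)
  have hHd : MDifferentiableAt ((𝓡 n).prod (𝓡 m)) (𝓡 m)
      (fun q : M × 𝔼 m => s q.1 + Q.proj q.1 q.2) (x, 0) := (hHs _).mdifferentiableAt (by simp)
  have hchain : mfderiv 𝓘(ℝ, 𝔼 n × 𝔼 k') (𝓡 m) (P.zeroSetMap hk s) (Q.retr (x, 0))
      (mfderiv ((𝓡 n).prod (𝓡 m)) 𝓘(ℝ, 𝔼 n × 𝔼 k') Q.retr (x, 0) (X, W)) =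
      mfderiv ((𝓡 n).prod (𝓡 m)) (𝓡 m) (fun q : M × 𝔼 m => s q.1 + Q.proj q.1 q.2) (x, 0) (X, W) := by
    have h := mfderiv_comp (x, (0 : 𝔼 m)) hGd hr
    rw [hH] at h
    exact (DFunLike.congr_fun h (X, W)).symm
  rw [hchain]
  -- read `dH_{(x,0)}` as a plain linear map and split `(X, W) = (X, 0) + (0, W)`
  obtain ⟨f, hf⟩ : ∃ f : (𝔼 n × 𝔼 m) →L[ℝ] 𝔼 m, ∀ S, f S =
      mfderiv ((𝓡 n).prod (𝓡 m)) (𝓡 m) (fun q : M × 𝔼 m => s q.1 + Q.proj q.1 q.2) (x, 0) S :=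
    ⟨_, fun _ => rfl⟩
  have hsplit : f (X, W) = f (X, 0) + f (0, W) := by
    rw [← map_add, Prod.mk_add_mk, add_zero, zero_add]
  -- the horizontal slice is `s` (`Q_y 0 = 0`)
  have h1 : f (X, 0) = ediff n m s x X := by
    rw [hf]
    have hι : ContMDiff (𝓡 n) ((𝓡 n).prod (𝓡 m)) ∞ fun y : M => (y, (0 : 𝔼 m)) :=
      contMDiff_id.prodMk contMDiff_const
    have hslice : (fun q : M × 𝔼 m => s q.1 + Q.proj q.1 q.2) ∘ (fun y : M => (y, (0 : 𝔼 m))) = s := by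
      funext y
      simp
    have h := mfderiv_comp x (g := fun q : M × 𝔼 m => s q.1 + Q.proj q.1 q.2)
      (f := fun y : M => (y, (0 : 𝔼 m))) hHd ((hι x).mdifferentiableAt (by simp))
    rw [hslice, mfderiv_prod_left] at h
    have h' := DFunLike.congr_fun h X
    exact h'.symm
  -- the vertical slice is `Q_x` (`mfderiv_slice_right_apply` and linearity in `w`)
  have h2 : f (0, W) = Q.proj x W := by
    rw [hf, ← mfderiv_slice_right_apply hHd]
    have hfun : (fun w : 𝔼 m => s ((x, w) : M × 𝔼 m).1 + Q.proj ((x, w) : M × 𝔼 m).1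
        ((x, w) : M × 𝔼 m).2) = fun w => s x + Q.proj x w := rfl
    rw [hfun, mfderiv_eq_fderiv, fderiv_const_add, ContinuousLinearMap.fderiv]
    rfl
  rw [← hf, hsplit, h1, h2]

/-! ### The zero set as a regular preimage -/
set_option maxHeartbeats 400000 in -- buildfix (bf3-g26): 160k/180k FAIL, 200k PASS at accept time; line-neutral budget line
include hk in
/-- **The zero set of a transverse section is an embedded submanifold.** For a rank-`k`
projection-field bundle `P` over an `n`-manifold `M` (Hausdorff, second countable), a `C^∞`
section `s` (`P s = s`) with transverse zeros, `k + k' = m` and `k + d = n`, there are a `C^∞` `d`-manifold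
`Z` and an injective `C^∞` immersion `ι : Z → M`, a topological embedding onto `{s = 0}`, with
`range dι_z = {v | P_x (ds_x v) = 0}`. [cite: HirschDT1976, Ch. 1 Thm. 3.2] -/
theorem exists_zeroSetManifold [T2Space M] [SecondCountableTopology M] {d : ℕ} (hd : k + d = n)
    {s : M → 𝔼 m} (hs : ContMDiff (𝓡 n) (𝓡 m) ∞ s) (hsec : ∀ x, P.proj x (s x) = s x)
    (htr : ∀ x, s x = 0 → ∀ w ∈ P.fibre x, ∃ v : 𝔼 n, P.proj x (ediff n m s x v) = w) :
    ∃ (Z : Type u) (_ : TopologicalSpace Z) (_ : T2Space Z) (_ : SecondCountableTopology Z)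
      (_ : ChartedSpace (𝔼 d) Z) (_ : IsManifold (𝓡 d) ∞ Z) (ι : Z → M),
      ContMDiff (𝓡 d) (𝓡 n) ∞ ι ∧ Topology.IsEmbedding ι ∧ range ι = {x | s x = 0} ∧
      (∀ z, Injective (mfderiv (𝓡 d) (𝓡 n) ι z)) ∧
      ∀ (z : Z) (v : 𝔼 n), (∃ u : 𝔼 d, mfderiv (𝓡 d) (𝓡 n) ι z u = v) ↔
        P.proj (ι z) (ediff n m s (ι z) v) = 0 := by
  -- the total space of `E^⊥`, re-charted on `ℝⁿ⁺ᵏ'`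
  set Q := P.compl hk with hQ
  have hfr : finrank ℝ (𝔼 n × 𝔼 k') = finrank ℝ (𝔼 (n + k')) := by
    simp [Module.finrank_prod]
  let L : (𝔼 n × 𝔼 k') ≃L[ℝ] 𝔼 (n + k') := ContinuousLinearEquiv.ofFinrankEq hfr
  let IT := 𝓘(ℝ, 𝔼 n × 𝔼 k')
  let V : Type u := Remodel IT L Q.Total
  let oR : V → Q.Total := Remodel.ofRemodel
  let tR : Q.Total → V := Remodel.toRemodel IT L Q.Total
  have hoR : ContMDiff (𝓡 (n + k')) IT ∞ oR := Remodel.contMDiff_ofRemodel _ _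
  have htR : ContMDiff IT (𝓡 (n + k')) ∞ tR := Remodel.contMDiff_toRemodel _ _
  have hoRd : ∀ v, MDifferentiableAt (𝓡 (n + k')) IT oR v := fun v =>
    (hoR v).mdifferentiableAt (by simp)
  have hoRbij : ∀ v, Bijective (mfderiv (𝓡 (n + k')) IT oR v) := fun v =>
    Remodel.bijective_mfderiv_ofRemodel IT L (M := Q.Total) (n := ∞) (by simp) v
  -- the defining map
  let Gt : Q.Total → 𝔼 m := P.zeroSetMap hk s
  have hGt : ContMDiff IT (𝓡 m) ∞ Gt := P.contMDiff_zeroSetMap hk hs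
  have hGtd : ∀ p, MDifferentiableAt IT (𝓡 m) Gt p := fun p => (hGt p).mdifferentiableAt (by simp)
  let G : V → 𝔼 m := Gt ∘ oR
  have hG : ContMDiff (𝓡 (n + k')) (𝓡 m) ∞ G := hGt.comp hoR
  have hGd : ∀ v, MDifferentiableAt (𝓡 (n + k')) (𝓡 m) G v := fun v =>
    (hG v).mdifferentiableAt (by simp)
  have hGcomp : ∀ v ξ, mfderiv (𝓡 (n + k')) (𝓡 m) G v ξ =
      mfderiv IT (𝓡 m) Gt (oR v) (mfderiv (𝓡 (n + k')) IT oR v ξ) := fun v ξ => by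
    rw [show G = Gt ∘ oR from rfl, mfderiv_comp v (g := Gt) (f := oR) (hGtd _) (hoRd v)]
    rfl
  -- zeros of `Gt` are `retr (x, 0)` with `s x = 0`
  have hzero : ∀ p : Q.Total, Gt p = 0 → s (Q.base p) = 0 ∧ p = Q.retr (Q.base p, 0) := by
    intro p hp
    obtain ⟨h1, h2⟩ := (P.zeroSetMap_eq_zero_iff hk hsec p).1 hp
    refine ⟨h1, ?_⟩
    apply Subtype.ext
    show Q.incl p = (Q.base p, Q.proj (Q.base p) 0)
    rw [map_zero]
    exact Prod.ext rfl h2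
  -- `dGt` is onto at the zeros
  have hGtsurj : ∀ x, s x = 0 → Surjective (mfderiv IT (𝓡 m) Gt (Q.retr (x, 0))) := by
    intro x hx (u : 𝔼 m)
    obtain ⟨v, hv⟩ := htr x hx (P.proj x u) (P.proj_mem_fibre x u)
    refine ⟨mfderiv ((𝓡 n).prod (𝓡 m)) IT Q.retr (x, 0) (v, u - ediff n m s x v), ?_⟩
    rw [P.mfderiv_zeroSetMap_retr hk hs, compl_proj_apply, map_sub, hv]
    abel
  -- the open set where `dG` is onto, as an open submanifold
  have hWo : IsOpen {v : V | Surjective (mfderiv (𝓡 (n + k')) (𝓡 m) G v)} :=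
    isOpen_setOf_surjective_mfderiv hG
  let U : TopologicalSpace.Opens V := ⟨{v : V | Surjective (mfderiv (𝓡 (n + k')) (𝓡 m) G v)}, hWo⟩
  let G' : U → 𝔼 m := G ∘ Subtype.val
  have hval : ContMDiff (𝓡 (n + k')) (𝓡 (n + k')) ∞ (Subtype.val : U → V) := contMDiff_subtype_val
  have hG' : ContMDiff (𝓡 (n + k')) (𝓡 m) ∞ G' := hG.comp hval
  have hG'comp : ∀ (w : U) ξ, mfderiv (𝓡 (n + k')) (𝓡 m) G' w ξ =
      mfderiv (𝓡 (n + k')) (𝓡 m) G w.1 ξ := fun w ξ => by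
    rw [show G' = G ∘ Subtype.val from rfl,
      mfderiv_comp w (g := G) (f := (Subtype.val : U → V)) (hGd _) (mdifferentiableAt_subtype_val w)]
    show mfderiv (𝓡 (n + k')) (𝓡 m) G w.1 (mfderiv (𝓡 (n + k')) (𝓡 (n + k'))
      (Subtype.val : U → V) w ξ) = _
    rw [DFunLike.congr_fun (mfderiv_subtype_val (I := 𝓡 (n + k')) w) ξ]
    rfl
  have hG'surj : ∀ w : U, Surjective (mfderiv (𝓡 (n + k')) (𝓡 m) G' w) := fun w c => by
    obtain ⟨ξ, hξ⟩ := w.2 c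
    exact ⟨ξ, by rw [hG'comp]; exact hξ⟩
  -- the regular preimage
  have hdim : n + k' = d + m := by omega
  obtain ⟨Z, _, _, _, _, _, e, he, hrange, hker⟩ :=
    exists_regularPreimage m d (n + k') hdim U G' hG' hG'surj 0
  have hes : ContMDiff (𝓡 d) (𝓡 (n + k')) ∞ e := he.contMDiff
  have hed : ∀ z, MDifferentiableAt (𝓡 d) (𝓡 (n + k')) e z := fun z =>
    (hes z).mdifferentiableAt (by simp)
  have heinj : ∀ z, Injective (mfderiv (𝓡 d) (𝓡 (n + k')) e z) := fun z =>
    injective_mfderiv_of_isImmersionAt' (he.isImmersion.isImmersionAt z)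
  -- the map to `M`
  let T : Z → Q.Total := fun z => oR (e z).1
  have hT : ContMDiff (𝓡 d) IT ∞ T := hoR.comp (hval.comp hes)
  let ι : Z → M := fun z => Q.base (T z)
  have hι : ContMDiff (𝓡 d) (𝓡 n) ∞ ι := Q.contMDiff_base.comp hT
  have hGT : ∀ z, Gt (T z) = 0 := fun z => by
    have : e z ∈ G' ⁻¹' {0} := by
      rw [← hrange]
      exact mem_range_self z
    exact this
  have hsι : ∀ z, s (ι z) = 0 := fun z => (hzero _ (hGT z)).1
  have hTeq : ∀ z, T z = Q.retr (ι z, 0) := fun z => (hzero _ (hGT z)).2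
  -- differential of `T`
  have hTd : ∀ z u, mfderiv (𝓡 d) IT T z u =
      mfderiv (𝓡 (n + k')) IT oR (e z).1 (mfderiv (𝓡 d) (𝓡 (n + k')) e z u) := by
    intro z u
    have h1 : mfderiv (𝓡 d) (𝓡 (n + k')) (Subtype.val ∘ e) z =
        (mfderiv (𝓡 (n + k')) (𝓡 (n + k')) (Subtype.val : U → V) (e z)).comp
          (mfderiv (𝓡 d) (𝓡 (n + k')) e z) :=
      mfderiv_comp z (g := (Subtype.val : U → V)) (f := e) (mdifferentiableAt_subtype_val _) (hed z)
    have h2 : mfderiv (𝓡 d) IT T z = (mfderiv (𝓡 (n + k')) IT oR (e z).1).comp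
        (mfderiv (𝓡 d) (𝓡 (n + k')) (Subtype.val ∘ e) z) :=
      mfderiv_comp z (g := oR) (f := Subtype.val ∘ e) (hoRd _)
        ((mdifferentiableAt_subtype_val _).comp z (hed z))
    rw [h2, h1]
    show mfderiv (𝓡 (n + k')) IT oR (e z).1 (mfderiv (𝓡 (n + k')) (𝓡 (n + k'))
      (Subtype.val : U → V) (e z) (mfderiv (𝓡 d) (𝓡 (n + k')) e z u)) = _
    rw [DFunLike.congr_fun (mfderiv_subtype_val (I := 𝓡 (n + k')) (e z)) _]
    rfl
  have hTd_inj : ∀ z, Injective (mfderiv (𝓡 d) IT T z) := fun z => by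
    intro u u' h
    rw [hTd, hTd] at h
    exact heinj z ((hoRbij _).1 h)
  have hTd_mem : ∀ z u, mfderiv IT (𝓡 m) Gt (T z) (mfderiv (𝓡 d) IT T z u) = 0 := by
    intro z u
    rw [hTd, ← hGcomp, ← hG'comp]
    exact (hker z _).2 ⟨u, rfl⟩
  have hιd : ∀ z u, mfderiv (𝓡 d) (𝓡 n) ι z u =
      mfderiv IT (𝓡 n) Q.base (T z) (mfderiv (𝓡 d) IT T z u) := by
    intro z u
    have h := mfderiv_comp z (g := Q.base) (f := T)
      ((Q.contMDiff_base _).mdifferentiableAt (by simp)) ((hT z).mdifferentiableAt (by simp))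
    exact DFunLike.congr_fun h u
  -- lifted-vector description of a tangent vector `ξ` at `T z = retr (x, 0)`
  have hlift : ∀ (z : Z) (ξ : TangentSpace IT (T z)), ∃ S : 𝔼 n × 𝔼 m,
      mfderiv ((𝓡 n).prod (𝓡 m)) IT Q.retr (ι z, 0) S = ξ ∧
      mfderiv IT (𝓡 n) Q.base (T z) ξ = S.1 ∧
      mfderiv IT (𝓡 m) Gt (T z) ξ = ediff n m s (ι z) S.1 + Q.proj (ι z) S.2 := by
    intro z ξ
    have hTz := hTeq z
    obtain ⟨S, hS⟩ : ∃ S : 𝔼 n × 𝔼 m, S = mfderiv IT ((𝓡 n).prod (𝓡 m)) Q.incl (T z) ξ :=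
      ⟨_, rfl⟩
    have hincl : Q.incl (T z) = (ι z, 0) := by
      rw [hTz]
      exact Prod.ext rfl (map_zero (Q.proj (ι z)))
    have hretr : mfderiv ((𝓡 n).prod (𝓡 m)) IT Q.retr (ι z, 0) S = ξ := by
      have h := Q.mfderiv_retr_mfderiv_incl (T z) ξ
      rw [hincl] at h
      rw [hS]
      exact h
    refine ⟨S, hretr, ?_, ?_⟩
    · rw [hS, Q.mfderiv_incl_eq]
    · rw [← hretr, hTz]
      exact P.mfderiv_zeroSetMap_retr hk hs (ι z) S.1 S.2
  refine ⟨Z, inferInstance, inferInstance, inferInstance, inferInstance, inferInstance, ι, hι,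
    ?_, ?_, ?_, ?_⟩
  · -- topological embedding: `(·, 0) ∘ ι = incl ∘ oR ∘ val ∘ e` is an embedding
    have h1 : Topology.IsEmbedding (fun z => ((e z : V))) :=
      Topology.IsEmbedding.subtypeVal.comp he.isEmbedding
    have h2 : Topology.IsEmbedding oR :=
      (Remodel.homeomorph IT L (M := Q.Total)).symm.isEmbedding
    have h4 : Topology.IsEmbedding (Q.incl ∘ T) := Q.isEmbedding_incl.comp (h2.comp h1)
    have h5 : Q.incl ∘ T = (fun x : M => (x, (0 : 𝔼 m))) ∘ ι := by
      funext z
      show Q.incl (T z) = (ι z, 0)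
      rw [hTeq z]
      exact Prod.ext rfl (map_zero (Q.proj (ι z)))
    rw [h5] at h4
    exact Topology.IsEmbedding.of_comp hι.continuous (continuous_id.prodMk continuous_const) h4
  · -- range
    apply Subset.antisymm
    · rintro _ ⟨z, rfl⟩
      exact hsι z
    · intro x hx
      have hx0 : s x = 0 := hx
      let p₀ : Q.Total := Q.retr (x, 0)
      have hsurj : Surjective (mfderiv (𝓡 (n + k')) (𝓡 m) G (tR p₀)) := by
        intro c
        obtain ⟨ξ, hξ⟩ := hGtsurj x hx0 c
        obtain ⟨ζ, hζ⟩ := (hoRbij (tR p₀)).2 ξ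
        refine ⟨ζ, ?_⟩
        rw [hGcomp]
        have : oR (tR p₀) = p₀ := rfl
        rw [this] at hζ ⊢
        rw [hζ]
        exact hξ
      have hw : (⟨tR p₀, hsurj⟩ : U) ∈ range e := by
        rw [hrange]
        show G (tR p₀) = 0
        show Gt p₀ = 0
        show s x + Q.proj x 0 = 0
        rw [hx0, map_zero, add_zero]
      obtain ⟨z, hz⟩ := hw
      refine ⟨z, ?_⟩
      show Q.base (oR (e z).1) = x
      rw [hz]
      rfl
  · -- immersion
    intro z u u' huu
    apply hTd_inj z
    have h0 : mfderiv (𝓡 d) (𝓡 n) ι z (u - u') = 0 := by rw [map_sub, huu, sub_self]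
    suffices hξ : mfderiv (𝓡 d) IT T z (u - u') = 0 by
      have := (mfderiv (𝓡 d) IT T z).map_sub u u'
      rw [hξ] at this
      exact (sub_eq_zero.1 this.symm)
    obtain ⟨⟨X, W⟩, hretr, hbase, hGt'⟩ := hlift z (mfderiv (𝓡 d) IT T z (u - u'))
    have hX : X = 0 := by rw [show X = (X, W).1 from rfl, ← hbase, ← hιd]; exact h0
    subst hX
    have hQW : Q.proj (ι z) W = 0 := by
      have h := hTd_mem z (u - u')
      rw [hGt', map_zero, zero_add] at h
      exact h
    refine Q.eq_zero_of_mfderiv_base_vec_eq_zero (T z) _ (by rw [hbase]; rfl) ?_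
    rw [← hretr]
    have h := Q.mfderiv_vec_mfderiv_retr_inr (ι z) 0 W
    rw [hQW] at h
    rw [← hTeq z] at h
    exact h
  · -- tangent spaces
    intro z v
    constructor
    · rintro ⟨u, rfl⟩
      obtain ⟨⟨X, W⟩, hretr, hbase, hGt'⟩ := hlift z (mfderiv (𝓡 d) IT T z u)
      rw [hιd, hbase]
      have h := hTd_mem z u
      rw [hGt'] at h
      -- apply `P_x`: `P (ds X) + P (W - P W) = 0`
      have h0 : ediff n m s (ι z) X + Q.proj (ι z) W = (0 : 𝔼 m) := h
      have h' := congrArg (P.proj (ι z)) h0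
      rw [map_add, compl_proj_apply, map_sub, P.proj_proj, sub_self, add_zero, map_zero] at h'
      exact h'
    · intro hv
      -- the lifted vector `ξ = d retr (v, -ds v)` is in `ker dGt`
      have hQv : Q.proj (ι z) (ediff n m s (ι z) v) = ediff n m s (ι z) v := by
        rw [compl_proj_apply, hv, sub_zero]
      obtain ⟨ξ, hξdef⟩ : ∃ ξ : 𝔼 n × 𝔼 k',
          ξ = mfderiv ((𝓡 n).prod (𝓡 m)) IT Q.retr (ι z, 0) (v, -ediff n m s (ι z) v) := ⟨_, rfl⟩
      have hξ0 : mfderiv IT (𝓡 m) Gt (T z) ξ = 0 := by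
        rw [hTeq z, hξdef, P.mfderiv_zeroSetMap_retr hk hs, map_neg, hQv, add_neg_cancel]
        rfl
      have hbase : mfderiv IT (𝓡 n) Q.base (T z) ξ = v := by
        rw [hTeq z, hξdef]
        exact Q.mfderiv_base_mfderiv_retr (ι z, 0) (v, -ediff n m s (ι z) v)
      obtain ⟨ζ, hζ⟩ := (hoRbij (e z).1).2 ξ
      have hG'ζ : mfderiv (𝓡 (n + k')) (𝓡 m) G' (e z) ζ = 0 := by
        rw [hG'comp, hGcomp]
        show mfderiv IT (𝓡 m) Gt (T z) (mfderiv (𝓡 (n + k')) IT oR (e z).1 ζ) = 0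
        rw [hζ]
        exact hξ0
      obtain ⟨u, hu⟩ := (hker z ζ).1 hG'ζ
      refine ⟨u, ?_⟩
      rw [hιd, hTd, hu, hζ]
      exact hbase

end ProjBundle

end Literature.Topology.Immersions
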